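import Literature.NumberTheory.Rogawski1990.PreStabilisationRegularSelf
import Literature.NumberTheory.Rogawski1990.PreStabilisationKappaTermsByEndoscopicClass
import Literature.NumberTheory.Rogawski1990.AdelicDeltaTransferAssembly
import HarnessLib

/-!
# The regular elliptic pre-stabilisation with the `χ ≠ 1` side SUMMED OVER THE ENDOSCOPIC CLASSES `{𝒪H ↦ 𝒪_st(γ₀)}`, class by class:
# `Φ^st_{μA}(𝒪_st(γ₀), f′) = α · (#{𝒪H ↦ 𝒪} + 1)⁻¹ · (Φ^{st,𝐀}_{G′}(γ₀, f′) + Σ_{𝒪H ↦ 𝒪} Φ^{st,𝐀}_H(γ_H(𝒪H), f′^H))` (Rogawski 1990, §5.4 (5.4.2)–(5.4.5) pp. 72–74, (4.3.3) p. 44)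

Topic `NumberTheory/Rogawski1990`; namespace `Literature.NumberTheory.Rogawski1990`; **THEOREMS ONLY** (no definition, no named fact, no instance, no notation, no
`sorry`).  Cell `pub/hodgecm-mathlib`, ENGINE T1 (crux H413 = `stmt-HodgeConjecture-24833`), row O11-1 cut **(O11-1c)** «the χ ≠ 1 side summed over `{𝒪H ↦ 𝒪_st(γ₀)}`,
class by class, in ED. 4's binder shapes» (RULING #101 (3)(B): «T1b comes out of O11-1 (4c) + κ = 1 transfer + G2 Δ-assembly class by class», the constants
`κG 𝒪 = ((Nat.card {𝒪H ∕∕ transfersTo 𝒪H 𝒪} + 1 : ℕ) : ℝ)⁻¹` = RULING #102 (2) `anchorKappaG`'s subtype literally).  HC_CM is proved only modulo the printed citations until rung 0 closes.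

The three ★ inputs, BY NAME:
* ★ O11-1 spine (`PreStabilisationRegularSelf`, F0P3a-p01 (g4)) `adelicStableOrbitalIntegral_stableClassOf_eq_mul_inv_card_mul_of_equiv`:
  `Φ^st_{μA}(𝒪_st(γ₀), T.eval) = r · |𝓡|⁻¹ · (Φ^{st,𝐀}_{G′}(γ₀; ofLocalAdelic mG mGi; T.eval) + Σ_{i ∈ I} adelicKappaOrbitalSum 𝒞′_𝐀(γ₀) (W i) …)`, `|𝓡| = |I| + 1`, for a
  stabilisation package `(𝓡, obs, e : I ≃ 𝓡 ∖ {1}, hHasse, W, hW)`;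
* ★ (O11-1b) (`PreStabilisationKappaTermsByEndoscopicClass`) the termwise bridge `adelicKappaOrbitalSum 𝒞′_𝐀(γ₀) (W i) = adelicKappaOrbitalIntegralG' L H′ γ_H (W i)` along
  norm-paired representatives `γ_H → γ₀` of the transferring classes, `G`-regular when `γ₀` is regular;
* ★ G2 (`AdelicDeltaTransferAssembly`, A-p01 (g14)) `MatchingAdele.adelicKappaOrbitalIntegralG'_ofLocalAdelic_eq_adelicStableOrbitalIntegralH_of_globalKappaFormula`:
  `Φ^{κ,𝐀}_{G′}(γ_H; w; ofLocalAdelic mG mGi; T.eval) = Φ^{st,𝐀}_H(γ_H; ofLocalAdelicPair mH mHi; T^H.eval)` when `w [γ̄] = κ(obs γ̄)` on the `γ_H`-carrier and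
  (4.3.3) `GlobalKappaFormula L H′ Δ Δ_∞ obs κ` holds, with the Δ-transfers `T^H` of `T` place by place.

WHAT IS PROVED, with the INDEX `I := {𝒪H : StableClassH ∕∕ 𝒪H ↦ 𝒪_st(γ₀)}` of ED. 4's package (★-to-be `TransferFactsStabilisation`, A-p06 (g20): `e : I ≃ {χ ∈ 𝓡 ∣ χ ≠ 1}`,
`hHasse`, and the κ-clause `∀ γ_H (hγ : γ_H → γ₀), GlobalKappaFormula L H′ Δ Δ_∞ (obs ∘ toSelf hγ) (e ⟨𝒪′_st(γ_H), hγ⟩)` — taken here as HYPOTHESES in exactly those shapes):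
* §1 the ADAPTER between the two carriers (RULING #101 (Q2)): the spine's class weights `hW : W i ⟦q.adele⟧ = (e i)(obs q)` on the SELF carrier give G2's
  `hw : w ⟦p.adele⟧ = κ(obs′ p)` on the `γ_H`-carrier with `obs′ := obs ∘ MatchingAdele.toSelf hγ`, `κ := e ⟨𝒪′_st(γ_H), hγ⟩` (★ `MatchingAdele.adele_toSelf`);
* §2 PER CLASS `𝒪H ↦ 𝒪_st(γ₀)` with representative `γ_H`: `adelicKappaOrbitalSum 𝒞′_𝐀(γ₀) (W 𝒪H) (ofLocalAdelic mG mGi) T.eval = Φ^{st,𝐀}_H(γ_H; ofLocalAdelicPair mH mHi; T^H.eval)`,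
  and SUMMED over `I` against the chosen representatives `𝒪H.out` (the anchor of the engine's `SJ_H`, ★ `adelicStableOrbitalIntegralH_out_eq`);
* §3 **THE ENGINE LINE**: `Φ^st_{μA}(𝒪_st(γ₀), T.eval) = r · (#I + 1)⁻¹ · (Φ^{st,𝐀}_{G′}(γ₀; ofLocalAdelic mG mGi; T.eval) + Σᶠ_{𝒪H ∈ I} Φ^{st,𝐀}_H(𝒪H.out; ofLocalAdelicPair mH mHi; T^H.eval))`
  — print's (5.4.2)–(5.4.5) with (4.3.3) inserted, `|𝓡(G_γ₀∕F)| = 1 + #{𝒪H ↦ 𝒪}` READ OFF `e`; what is left to the engine's pins is the `κ = 1` inner transfer of the first term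
  (★ G1 `AdelicInnerTransferAssembly`) and the constants `κG`, `κH`.

## References
* [Rogawski1990] J. D. Rogawski, *Automorphic Representations of Unitary Groups in Three Variables*, Ann. of Math. Stud. 123 (1990), §3.3 Prop. 3.3.1 p. 22, §4.3
  (4.3.1)–(4.3.3) pp. 43–44, §5.4 (5.4.1)–(5.4.5) pp. 72–74, §14.5 Thm. 14.5.1 (a) p. 238.
* [Kottwitz1986] R. E. Kottwitz, *Stable trace formula: elliptic singular terms*, Math. Ann. 275 (1986), Prop. 7.1, §9.
* [LanglandsShelstad1987] R. P. Langlands, D. Shelstad, *On the definition of transfer factors*, Math. Ann. 278 (1987), Thm. 6.4.B.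
* [Langlands1983] R. P. Langlands, *Les débuts d'une formule des traces stable*, Publ. Math. Univ. Paris VII 13 (1983).
-/

set_option autoImplicit false

noncomputable section

open MeasureTheory NumberField IsDedekindDomain Filter Function
open scoped Matrix MatrixGroups ENNReal BigOperators

namespace Literature.NumberTheory.Rogawski1990

open Literature.NumberTheory.Automorphic Literature.NumberTheory.Automorphic.UnitaryGroup Literature.MeasureTheory.Group
open Literature.AlgebraicGeometry.ShimuraVarieties (unitaryGroup)

/-! ## §1 The adapter between the self carrier and the `γ_H`-carrier for the class weights -/

section Adapter

variable {L : Type} [Field L] [NumberField L] [IsCMField L] {H' : Matrix (Fin 3) (Fin 3) L} {γ₀ : (UnitaryGroup.cmDatum L 3 H').Rational}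
variable {A : Type*} [AddCommGroup A] (𝓡 : Subgroup (AddChar A ℂ)) (obs : MatchingAdeleG₂ L H' H' γ₀ → A)
  (e : {𝒪H : StableClassH (cmConjRingHom L) (Matrix.of fun i j : Fin 2 => if i.val + j.val + 1 = 2 then (1 : L) else 0)
      (Matrix.of fun i j : Fin 1 => if i.val + j.val + 1 = 1 then (1 : L) else 0) //
        𝒪H.TransfersTo H' endoForm_antidiagOne (stableClassOf (cmConjRingHom L) H' γ₀)} ≃ {χ : 𝓡 // χ ≠ 1})
  (W : {𝒪H : StableClassH (cmConjRingHom L) (Matrix.of fun i j : Fin 2 => if i.val + j.val + 1 = 2 then (1 : L) else 0)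
      (Matrix.of fun i j : Fin 1 => if i.val + j.val + 1 = 1 then (1 : L) else 0) //
        𝒪H.TransfersTo H' endoForm_antidiagOne (stableClassOf (cmConjRingHom L) H' γ₀)} → ConjClasses (UnitaryGroup.cmDatum L 3 H').Adelic → ℂ)

/-- **ADAPTER (self carrier ⟶ `γ_H`-carrier).**  If the class weights of the stabilisation package read `W i ⟦q.adele⟧ = (e i)(obs q)` on the matching adèles `q` of
the SELF carrier over `γ₀` (the spine's `hW`), then for every `γ_H → γ₀` representing `i` and every matching adèle `p` over `γ_H`:
`W i ⟦p.adele⟧ = (e i)(obs (toSelf p))` — G2's `hw` with `obs′ := obs ∘ MatchingAdele.toSelf hγ`, `κ := e i` (★ `MatchingAdele.adele_toSelf`: the adèle does not move).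
[cite: Rogawski1990, §4.3 (4.3.3) p. 44; §5.4 (5.4.3) p. 73] -/
theorem MatchingAdeleG₂.weight_mk_adele_eq_addChar_obs_toSelf
    (hW : ∀ i (q : MatchingAdeleG₂ L H' H' γ₀), W i (ConjClasses.mk q.adele) = (((e i : {χ : 𝓡 // χ ≠ 1}) : 𝓡) : AddChar A ℂ) (obs q))
    {γH : (UnitaryGroup.cmDatum L 2 (Matrix.of fun i j : Fin 2 => if i.val + j.val + 1 = 2 then (1 : L) else 0)).Rational ×
      (UnitaryGroup.cmDatum L 1 (Matrix.of fun i j : Fin 1 => if i.val + j.val + 1 = 1 then (1 : L) else 0)).Rational}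
    (hγ : IsNormPair L H' γH γ₀)
    (i : {𝒪H : StableClassH (cmConjRingHom L) (Matrix.of fun i j : Fin 2 => if i.val + j.val + 1 = 2 then (1 : L) else 0)
      (Matrix.of fun i j : Fin 1 => if i.val + j.val + 1 = 1 then (1 : L) else 0) //
        𝒪H.TransfersTo H' endoForm_antidiagOne (stableClassOf (cmConjRingHom L) H' γ₀)})
    (p : MatchingAdele L H' γH) :
    W i (ConjClasses.mk p.adele) = (((e i : {χ : 𝓡 // χ ≠ 1}) : 𝓡) : AddChar A ℂ) (obs (MatchingAdele.toSelf hγ p)) := by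
  have h := hW i (MatchingAdele.toSelf hγ p)
  rwa [MatchingAdele.adele_toSelf] at h

/-- The adapter at the INDEX `⟨𝒪′_st(γ_H), hγ⟩` ED. 4's κ-clause names (`κ := (e ⟨stableClassHOf γ_H, hγ⟩).1`). [cite: Rogawski1990, §5.4 (5.4.5) p. 74] -/
theorem MatchingAdeleG₂.weight_mk_adele_eq_addChar_obs_toSelf_mk
    (hW : ∀ i (q : MatchingAdeleG₂ L H' H' γ₀), W i (ConjClasses.mk q.adele) = (((e i : {χ : 𝓡 // χ ≠ 1}) : 𝓡) : AddChar A ℂ) (obs q))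
    {γH : (UnitaryGroup.cmDatum L 2 (Matrix.of fun i j : Fin 2 => if i.val + j.val + 1 = 2 then (1 : L) else 0)).Rational ×
      (UnitaryGroup.cmDatum L 1 (Matrix.of fun i j : Fin 1 => if i.val + j.val + 1 = 1 then (1 : L) else 0)).Rational}
    (hγ : IsNormPair L H' γH γ₀) (p : MatchingAdele L H' γH) :
    W ⟨stableClassHOf (cmConjRingHom L) _ _ γH, hγ⟩ (ConjClasses.mk p.adele) =
      (((e ⟨stableClassHOf (cmConjRingHom L) _ _ γH, hγ⟩ : {χ : 𝓡 // χ ≠ 1}) : 𝓡) : AddChar A ℂ) (obs (MatchingAdele.toSelf hγ p)) :=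
  MatchingAdeleG₂.weight_mk_adele_eq_addChar_obs_toSelf 𝓡 obs e W hW hγ _ p

end Adapter

/-! ## §2 Per class: the `χ ≠ 1` term of `𝒪H ↦ 𝒪_st(γ₀)` IS `Φ^{st,𝐀}_H(γ_H(𝒪H); f′^H)` -/

section PerClass

variable {L : Type} [Field L] [NumberField L] [IsCMField L] {H' : Matrix (Fin 3) (Fin 3) L} {γ₀ : (UnitaryGroup.cmDatum L 3 H').Rational}
  -- `G′(𝐀)`, `G′_v`, `G′_∞` orbit quotients (as in ★ G2)
  [∀ g : (UnitaryGroup.cmDatum L 3 H').Adelic,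
    MeasurableSpace ((UnitaryGroup.cmDatum L 3 H').Adelic ⧸ Subgroup.centralizer ({g} : Set (UnitaryGroup.cmDatum L 3 H').Adelic))]
  [∀ g : (UnitaryGroup.cmDatum L 3 H').Adelic,
    BorelSpace ((UnitaryGroup.cmDatum L 3 H').Adelic ⧸ Subgroup.centralizer ({g} : Set (UnitaryGroup.cmDatum L 3 H').Adelic))]
  [∀ (v : HeightOneSpectrum (𝓞 ↥(maximalRealSubfield L))) (x : (UnitaryGroup.cmDatum L 3 H').Local v),
    MeasurableSpace ((UnitaryGroup.cmDatum L 3 H').Local v ⧸ Subgroup.centralizer ({x} : Set ((UnitaryGroup.cmDatum L 3 H').Local v)))]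
  [∀ (v : HeightOneSpectrum (𝓞 ↥(maximalRealSubfield L))) (x : (UnitaryGroup.cmDatum L 3 H').Local v),
    BorelSpace ((UnitaryGroup.cmDatum L 3 H').Local v ⧸ Subgroup.centralizer ({x} : Set ((UnitaryGroup.cmDatum L 3 H').Local v)))]
  [∀ a : UnitaryGroup.arch (↥(maximalRealSubfield L)) L (IsCMField.complexConj L) 3 H',
    MeasurableSpace (UnitaryGroup.arch (↥(maximalRealSubfield L)) L (IsCMField.complexConj L) 3 H' ⧸
      Subgroup.centralizer ({a} : Set (UnitaryGroup.arch (↥(maximalRealSubfield L)) L (IsCMField.complexConj L) 3 H')))]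
  [∀ a : UnitaryGroup.arch (↥(maximalRealSubfield L)) L (IsCMField.complexConj L) 3 H',
    BorelSpace (UnitaryGroup.arch (↥(maximalRealSubfield L)) L (IsCMField.complexConj L) 3 H' ⧸
      Subgroup.centralizer ({a} : Set (UnitaryGroup.arch (↥(maximalRealSubfield L)) L (IsCMField.complexConj L) 3 H')))]
  [∀ v : HeightOneSpectrum (𝓞 ↥(maximalRealSubfield L)), MeasurableSpace ((UnitaryGroup.cmDatum L 3 H').Local v)]
  [∀ v : HeightOneSpectrum (𝓞 ↥(maximalRealSubfield L)), BorelSpace ((UnitaryGroup.cmDatum L 3 H').Local v)]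
  -- `H(𝐀)`, `H_v`, `H_∞` orbit quotients and `H_v` (as in ★ G2; ★ «C-H» `pairAdelic` ∕ `pairLocal` ∕ `pairArch` are the product carriers, reducibly)
  [∀ h : pairAdelic L (Matrix.of fun i j : Fin 2 => if i.val + j.val + 1 = 2 then (1 : L) else 0) (Matrix.of fun i j : Fin 1 => if i.val + j.val + 1 = 1 then (1 : L) else 0), MeasurableSpace (pairAdelic L (Matrix.of fun i j : Fin 2 => if i.val + j.val + 1 = 2 then (1 : L) else 0) (Matrix.of fun i j : Fin 1 => if i.val + j.val + 1 = 1 then (1 : L) else 0) ⧸ Subgroup.centralizer ({h} : Set (pairAdelic L (Matrix.of fun i j : Fin 2 => if i.val + j.val + 1 = 2 then (1 : L) else 0) (Matrix.of fun i j : Fin 1 => if i.val + j.val + 1 = 1 then (1 : L) else 0))))]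
  [∀ h : pairAdelic L (Matrix.of fun i j : Fin 2 => if i.val + j.val + 1 = 2 then (1 : L) else 0) (Matrix.of fun i j : Fin 1 => if i.val + j.val + 1 = 1 then (1 : L) else 0), BorelSpace (pairAdelic L (Matrix.of fun i j : Fin 2 => if i.val + j.val + 1 = 2 then (1 : L) else 0) (Matrix.of fun i j : Fin 1 => if i.val + j.val + 1 = 1 then (1 : L) else 0) ⧸ Subgroup.centralizer ({h} : Set (pairAdelic L (Matrix.of fun i j : Fin 2 => if i.val + j.val + 1 = 2 then (1 : L) else 0) (Matrix.of fun i j : Fin 1 => if i.val + j.val + 1 = 1 then (1 : L) else 0))))]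
  [∀ (v : HeightOneSpectrum (𝓞 ↥(maximalRealSubfield L))) (x : pairLocal L (Matrix.of fun i j : Fin 2 => if i.val + j.val + 1 = 2 then (1 : L) else 0) (Matrix.of fun i j : Fin 1 => if i.val + j.val + 1 = 1 then (1 : L) else 0) v),
    MeasurableSpace (pairLocal L (Matrix.of fun i j : Fin 2 => if i.val + j.val + 1 = 2 then (1 : L) else 0) (Matrix.of fun i j : Fin 1 => if i.val + j.val + 1 = 1 then (1 : L) else 0) v ⧸ Subgroup.centralizer ({x} : Set (pairLocal L (Matrix.of fun i j : Fin 2 => if i.val + j.val + 1 = 2 then (1 : L) else 0) (Matrix.of fun i j : Fin 1 => if i.val + j.val + 1 = 1 then (1 : L) else 0) v)))]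
  [∀ (v : HeightOneSpectrum (𝓞 ↥(maximalRealSubfield L))) (x : pairLocal L (Matrix.of fun i j : Fin 2 => if i.val + j.val + 1 = 2 then (1 : L) else 0) (Matrix.of fun i j : Fin 1 => if i.val + j.val + 1 = 1 then (1 : L) else 0) v),
    BorelSpace (pairLocal L (Matrix.of fun i j : Fin 2 => if i.val + j.val + 1 = 2 then (1 : L) else 0) (Matrix.of fun i j : Fin 1 => if i.val + j.val + 1 = 1 then (1 : L) else 0) v ⧸ Subgroup.centralizer ({x} : Set (pairLocal L (Matrix.of fun i j : Fin 2 => if i.val + j.val + 1 = 2 then (1 : L) else 0) (Matrix.of fun i j : Fin 1 => if i.val + j.val + 1 = 1 then (1 : L) else 0) v)))]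
  [∀ a : pairArch L (Matrix.of fun i j : Fin 2 => if i.val + j.val + 1 = 2 then (1 : L) else 0) (Matrix.of fun i j : Fin 1 => if i.val + j.val + 1 = 1 then (1 : L) else 0), MeasurableSpace (pairArch L (Matrix.of fun i j : Fin 2 => if i.val + j.val + 1 = 2 then (1 : L) else 0) (Matrix.of fun i j : Fin 1 => if i.val + j.val + 1 = 1 then (1 : L) else 0) ⧸ Subgroup.centralizer ({a} : Set (pairArch L (Matrix.of fun i j : Fin 2 => if i.val + j.val + 1 = 2 then (1 : L) else 0) (Matrix.of fun i j : Fin 1 => if i.val + j.val + 1 = 1 then (1 : L) else 0))))]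
  [∀ a : pairArch L (Matrix.of fun i j : Fin 2 => if i.val + j.val + 1 = 2 then (1 : L) else 0) (Matrix.of fun i j : Fin 1 => if i.val + j.val + 1 = 1 then (1 : L) else 0), BorelSpace (pairArch L (Matrix.of fun i j : Fin 2 => if i.val + j.val + 1 = 2 then (1 : L) else 0) (Matrix.of fun i j : Fin 1 => if i.val + j.val + 1 = 1 then (1 : L) else 0) ⧸ Subgroup.centralizer ({a} : Set (pairArch L (Matrix.of fun i j : Fin 2 => if i.val + j.val + 1 = 2 then (1 : L) else 0) (Matrix.of fun i j : Fin 1 => if i.val + j.val + 1 = 1 then (1 : L) else 0))))]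
  [∀ v : HeightOneSpectrum (𝓞 ↥(maximalRealSubfield L)), MeasurableSpace (pairLocal L (Matrix.of fun i j : Fin 2 => if i.val + j.val + 1 = 2 then (1 : L) else 0) (Matrix.of fun i j : Fin 1 => if i.val + j.val + 1 = 1 then (1 : L) else 0) v)]
  [∀ v : HeightOneSpectrum (𝓞 ↥(maximalRealSubfield L)), BorelSpace (pairLocal L (Matrix.of fun i j : Fin 2 => if i.val + j.val + 1 = 2 then (1 : L) else 0) (Matrix.of fun i j : Fin 1 => if i.val + j.val + 1 = 1 then (1 : L) else 0) v)]

/-- **PER CLASS: the `χ ≠ 1` term indexed by `𝒪H ↦ 𝒪_st(γ₀)` is the `H`-side adelic stable orbital integral at any representative `γ_H` of `𝒪H`.**  `H′` hermitian with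
`det ≠ 0`, `γ₀` regular (so every `γ_H → γ₀` is `G`-regular, ★ `IsNormPair.isGRegular_of_isRegularElt`); the stabilisation package `(𝓡, obs, e, W, hW)` in the spine's
shapes together with ED. 4's κ-clause `hκ` (4.3.3); the analytic data of ★ G2 `…_of_globalKappaFormula` VERBATIM (Δ a.e. trivial, `Tinf`, canonical `mG` with `ν_v(K_v) = 1`,
admissible `mGi`, `IsTest` pure tensor `T`; `νH`, canonical∕admissible `mH`, admissible `mHi`, the unramified `H`-side pure tensor `T^H` with continuous compactly supported
factors which are the Δ-transfers of `T` at every finite place and at `∞`).  THEN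
`adelicKappaOrbitalSum 𝒞′_𝐀(γ₀) (W i) (ofLocalAdelic mG mGi) T.eval = Φ^{st,𝐀}_H(γ_H; ofLocalAdelicPair mH mHi; T^H.eval)` for `𝒪′_st(γ_H) = i`.
[cite: Rogawski1990, §4.3 (4.3.1)–(4.3.3) pp. 43–44; §5.4 (5.4.3)–(5.4.5) pp. 73–74] [cite: Kottwitz1986, Prop. 7.1] [cite: LanglandsShelstad1987, Thm. 6.4.B] -/
theorem MatchingAdeleG₂.adelicKappaOrbitalSum_classes_eq_adelicStableOrbitalIntegralH_of_globalKappaFormula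
    (hH' : (H'.map (cmConjRingHom L))ᵀ = H') (hdet : H'.det ≠ 0) (hreg : IsRegularElt (γ₀.val : GL (Fin 3) L))
    (Δ : ∀ v : HeightOneSpectrum (𝓞 ↥(maximalRealSubfield L)), LocalTransferFactor L H' v) (hΔ : IsAlmostEverywhereTrivial L H' Δ)
    (Tinf : ArchTransferFactor L H')
    {A : Type} [AddCommGroup A] (𝓡 : Subgroup (AddChar A ℂ)) (obs : MatchingAdeleG₂ L H' H' γ₀ → A)
    (e : {𝒪H : StableClassH (cmConjRingHom L) (Matrix.of fun i j : Fin 2 => if i.val + j.val + 1 = 2 then (1 : L) else 0)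
        (Matrix.of fun i j : Fin 1 => if i.val + j.val + 1 = 1 then (1 : L) else 0) //
          𝒪H.TransfersTo H' endoForm_antidiagOne (stableClassOf (cmConjRingHom L) H' γ₀)} ≃ {χ : 𝓡 // χ ≠ 1})
    (hκ : ∀ (γH : (UnitaryGroup.cmDatum L 2 (Matrix.of fun i j : Fin 2 => if i.val + j.val + 1 = 2 then (1 : L) else 0)).Rational ×
        (UnitaryGroup.cmDatum L 1 (Matrix.of fun i j : Fin 1 => if i.val + j.val + 1 = 1 then (1 : L) else 0)).Rational) (hγ : IsNormPair L H' γH γ₀),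
      GlobalKappaFormula L H' Δ Tinf.Δ (fun p : MatchingAdele L H' γH => obs (MatchingAdele.toSelf hγ p))
        ((e ⟨stableClassHOf (cmConjRingHom L) _ _ γH, hγ⟩).1 : AddChar A ℂ))
    (W : {𝒪H : StableClassH (cmConjRingHom L) (Matrix.of fun i j : Fin 2 => if i.val + j.val + 1 = 2 then (1 : L) else 0)
        (Matrix.of fun i j : Fin 1 => if i.val + j.val + 1 = 1 then (1 : L) else 0) //
          𝒪H.TransfersTo H' endoForm_antidiagOne (stableClassOf (cmConjRingHom L) H' γ₀)} → ConjClasses (UnitaryGroup.cmDatum L 3 H').Adelic → ℂ)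
    (hW : ∀ i (q : MatchingAdeleG₂ L H' H' γ₀), W i (ConjClasses.mk q.adele) = (((e i : {χ : 𝓡 // χ ≠ 1}) : 𝓡) : AddChar A ℂ) (obs q))
    (ν : ∀ v : HeightOneSpectrum (𝓞 ↥(maximalRealSubfield L)), Measure ((UnitaryGroup.cmDatum L 3 H').Local v))
    [∀ v, (ν v).IsHaarMeasure] [∀ v, (ν v).IsMulRightInvariant]
    (hν : ∀ v, ν v (UnitaryGroup.cmLocalIntegralLevel L 3 H' v) = 1)
    (mG : ∀ v : HeightOneSpectrum (𝓞 ↥(maximalRealSubfield L)), OrbitalMeasureFamily ((UnitaryGroup.cmDatum L 3 H').Local v))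
    (hcan : ∀ v, (mG v).IsCanonical (fun x => IsRegularElt (x.val : GL (Fin 3) (UnitaryGroup.LocalRing L v))) (ν v))
    (mGi : OrbitalMeasureFamily (UnitaryGroup.arch (↥(maximalRealSubfield L)) L (IsCMField.complexConj L) 3 H'))
    (hadmA : mGi.IsAdmissibleOn fun a => IsRegularElt (a.val : GL (Fin 3) (mixedEmbedding.mixedSpace L)))
    (T : UnitaryGroup.PureTensor L 3 H') (hT : T.IsTest)
    (νH : ∀ v : HeightOneSpectrum (𝓞 ↥(maximalRealSubfield L)), Measure (pairLocal L (Matrix.of fun i j : Fin 2 => if i.val + j.val + 1 = 2 then (1 : L) else 0) (Matrix.of fun i j : Fin 1 => if i.val + j.val + 1 = 1 then (1 : L) else 0) v))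
    [∀ v, (νH v).IsHaarMeasure] [∀ v, (νH v).IsMulRightInvariant]
    (hνH : ∀ v, νH v ((UnitaryGroup.cmLocalIntegralLevel L 2 (Matrix.of fun i j : Fin 2 => if i.val + j.val + 1 = 2 then (1 : L) else 0) v : Set ((UnitaryGroup.cmDatum L 2 (Matrix.of fun i j : Fin 2 => if i.val + j.val + 1 = 2 then (1 : L) else 0)).Local v)) ×ˢ
      (UnitaryGroup.cmLocalIntegralLevel L 1 (Matrix.of fun i j : Fin 1 => if i.val + j.val + 1 = 1 then (1 : L) else 0) v : Set ((UnitaryGroup.cmDatum L 1 (Matrix.of fun i j : Fin 1 => if i.val + j.val + 1 = 1 then (1 : L) else 0)).Local v))) = 1)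
    (mH : ∀ v : HeightOneSpectrum (𝓞 ↥(maximalRealSubfield L)), OrbitalMeasureFamily (pairLocal L (Matrix.of fun i j : Fin 2 => if i.val + j.val + 1 = 2 then (1 : L) else 0) (Matrix.of fun i j : Fin 1 => if i.val + j.val + 1 = 1 then (1 : L) else 0) v))
    (mHi : OrbitalMeasureFamily (pairArch L (Matrix.of fun i j : Fin 2 => if i.val + j.val + 1 = 2 then (1 : L) else 0) (Matrix.of fun i j : Fin 1 => if i.val + j.val + 1 = 1 then (1 : L) else 0)))
    (hadmH : ∀ v, (mH v).IsAdmissibleOn (IsLocalGRegular L v)) (hcanH : ∀ v, (mH v).IsCanonical (IsLocalGRegular L v) (νH v))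
    (hadmAH : mHi.IsAdmissibleOn (IsArchGRegular L))
    (TH : PureTensor₂ L (Matrix.of fun i j : Fin 2 => if i.val + j.val + 1 = 2 then (1 : L) else 0) (Matrix.of fun i j : Fin 1 => if i.val + j.val + 1 = 1 then (1 : L) else 0)) (hTH : TH.IsUnramified₂) (hTc : ∀ v ∈ TH.S, HasCompactSupport (TH.loc v)) (hTa : HasCompactSupport TH.arch)
    (hTc' : ∀ v ∈ TH.S, Continuous (TH.loc v)) (hTa' : Continuous TH.arch)
    (hloc : ∀ v, IsLocalDeltaTransfer L H' v (Δ v) (mH v) (mG v) (TH.loc v) (T.loc v))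
    (harch : IsArchDeltaTransfer L H' Tinf mHi mGi TH.arch T.arch)
    (i : {𝒪H : StableClassH (cmConjRingHom L) (Matrix.of fun i j : Fin 2 => if i.val + j.val + 1 = 2 then (1 : L) else 0)
        (Matrix.of fun i j : Fin 1 => if i.val + j.val + 1 = 1 then (1 : L) else 0) //
          𝒪H.TransfersTo H' endoForm_antidiagOne (stableClassOf (cmConjRingHom L) H' γ₀)})
    {γH : (UnitaryGroup.cmDatum L 2 (Matrix.of fun i j : Fin 2 => if i.val + j.val + 1 = 2 then (1 : L) else 0)).Rational ×
      (UnitaryGroup.cmDatum L 1 (Matrix.of fun i j : Fin 1 => if i.val + j.val + 1 = 1 then (1 : L) else 0)).Rational}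
    (hi : stableClassHOf (cmConjRingHom L) _ _ γH = i.1) :
    adelicKappaOrbitalSum (MatchingAdeleG₂.classes L H' H' γ₀) (W i) (UnitaryGroup.OrbitalMeasureFamily.ofLocalAdelic L 3 H' mG mGi) T.eval =
      adelicStableOrbitalIntegralH L γH (OrbitalMeasureFamily.ofLocalAdelicPair L (Matrix.of fun i j : Fin 2 => if i.val + j.val + 1 = 2 then (1 : L) else 0) (Matrix.of fun i j : Fin 1 => if i.val + j.val + 1 = 1 then (1 : L) else 0) mH mHi) TH.eval := by
  have hγ : IsNormPair L H' γH γ₀ := StableClassH.isNormPair_of_transfersTo_of_eq i.2 hi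
  have hi' : (⟨stableClassHOf (cmConjRingHom L) _ _ γH, hγ⟩ : {𝒪H : StableClassH (cmConjRingHom L) (Matrix.of fun i j : Fin 2 => if i.val + j.val + 1 = 2 then (1 : L) else 0)
      (Matrix.of fun i j : Fin 1 => if i.val + j.val + 1 = 1 then (1 : L) else 0) //
        𝒪H.TransfersTo H' endoForm_antidiagOne (stableClassOf (cmConjRingHom L) H' γ₀)}) = i := Subtype.ext hi
  rw [← adelicKappaOrbitalIntegralG'_eq_adelicKappaOrbitalSum_classes hγ (W i) (UnitaryGroup.OrbitalMeasureFamily.ofLocalAdelic L 3 H' mG mGi) T.eval, ← hi']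
  exact MatchingAdele.adelicKappaOrbitalIntegralG'_ofLocalAdelic_eq_adelicStableOrbitalIntegralH_of_globalKappaFormula hH' hdet
    (hγ.isGRegular_of_isRegularElt hreg) hγ Δ hΔ Tinf (fun p => obs (MatchingAdele.toSelf hγ p)) _ (hκ γH hγ) (W _)
    (MatchingAdeleG₂.weight_mk_adele_eq_addChar_obs_toSelf_mk 𝓡 obs e W hW hγ) ν hν mG hcan mGi hadmA T hT νH hνH mH mHi hadmH hcanH hadmAH TH hTH hTc hTa
    hTc' hTa' hloc harch

/-- **SUMMED OVER `{𝒪H ↦ 𝒪_st(γ₀)}` against the CHOSEN representatives `𝒪H.out`** (the anchor of the engine's `SJ_H`, ★ `adelicStableOrbitalIntegralH_out_eq`; `Fintype` on the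
index as supplied — e.g. `Fintype.ofFinite` from ★ `StableClassH.finite_subtype_transfersTo_antidiagOne`):
`Σ_{i ∈ I} adelicKappaOrbitalSum 𝒞′_𝐀(γ₀) (W i) (ofLocalAdelic mG mGi) T.eval = Σᶠ_{𝒪H ∈ I} Φ^{st,𝐀}_H(𝒪H.out; ofLocalAdelicPair mH mHi; T^H.eval)`.
[cite: Rogawski1990, §5.4 (5.4.3)–(5.4.5) pp. 73–74; §4.3 (4.3.3) p. 44] [cite: Kottwitz1986, Prop. 7.1] [cite: LanglandsShelstad1987, Thm. 6.4.B] -/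
theorem MatchingAdeleG₂.sum_adelicKappaOrbitalSum_classes_eq_finsum_adelicStableOrbitalIntegralH_out_of_globalKappaFormula
    (hH' : (H'.map (cmConjRingHom L))ᵀ = H') (hdet : H'.det ≠ 0) (hreg : IsRegularElt (γ₀.val : GL (Fin 3) L))
    (Δ : ∀ v : HeightOneSpectrum (𝓞 ↥(maximalRealSubfield L)), LocalTransferFactor L H' v) (hΔ : IsAlmostEverywhereTrivial L H' Δ)
    (Tinf : ArchTransferFactor L H')
    {A : Type} [AddCommGroup A] (𝓡 : Subgroup (AddChar A ℂ)) (obs : MatchingAdeleG₂ L H' H' γ₀ → A)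
    [Fintype {𝒪H : StableClassH (cmConjRingHom L) (Matrix.of fun i j : Fin 2 => if i.val + j.val + 1 = 2 then (1 : L) else 0)
        (Matrix.of fun i j : Fin 1 => if i.val + j.val + 1 = 1 then (1 : L) else 0) //
          𝒪H.TransfersTo H' endoForm_antidiagOne (stableClassOf (cmConjRingHom L) H' γ₀)}]
    (e : {𝒪H : StableClassH (cmConjRingHom L) (Matrix.of fun i j : Fin 2 => if i.val + j.val + 1 = 2 then (1 : L) else 0)
        (Matrix.of fun i j : Fin 1 => if i.val + j.val + 1 = 1 then (1 : L) else 0) //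
          𝒪H.TransfersTo H' endoForm_antidiagOne (stableClassOf (cmConjRingHom L) H' γ₀)} ≃ {χ : 𝓡 // χ ≠ 1})
    (hκ : ∀ (γH : (UnitaryGroup.cmDatum L 2 (Matrix.of fun i j : Fin 2 => if i.val + j.val + 1 = 2 then (1 : L) else 0)).Rational ×
        (UnitaryGroup.cmDatum L 1 (Matrix.of fun i j : Fin 1 => if i.val + j.val + 1 = 1 then (1 : L) else 0)).Rational) (hγ : IsNormPair L H' γH γ₀),
      GlobalKappaFormula L H' Δ Tinf.Δ (fun p : MatchingAdele L H' γH => obs (MatchingAdele.toSelf hγ p))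
        ((e ⟨stableClassHOf (cmConjRingHom L) _ _ γH, hγ⟩).1 : AddChar A ℂ))
    (W : {𝒪H : StableClassH (cmConjRingHom L) (Matrix.of fun i j : Fin 2 => if i.val + j.val + 1 = 2 then (1 : L) else 0)
        (Matrix.of fun i j : Fin 1 => if i.val + j.val + 1 = 1 then (1 : L) else 0) //
          𝒪H.TransfersTo H' endoForm_antidiagOne (stableClassOf (cmConjRingHom L) H' γ₀)} → ConjClasses (UnitaryGroup.cmDatum L 3 H').Adelic → ℂ)
    (hW : ∀ i (q : MatchingAdeleG₂ L H' H' γ₀), W i (ConjClasses.mk q.adele) = (((e i : {χ : 𝓡 // χ ≠ 1}) : 𝓡) : AddChar A ℂ) (obs q))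
    (ν : ∀ v : HeightOneSpectrum (𝓞 ↥(maximalRealSubfield L)), Measure ((UnitaryGroup.cmDatum L 3 H').Local v))
    [∀ v, (ν v).IsHaarMeasure] [∀ v, (ν v).IsMulRightInvariant]
    (hν : ∀ v, ν v (UnitaryGroup.cmLocalIntegralLevel L 3 H' v) = 1)
    (mG : ∀ v : HeightOneSpectrum (𝓞 ↥(maximalRealSubfield L)), OrbitalMeasureFamily ((UnitaryGroup.cmDatum L 3 H').Local v))
    (hcan : ∀ v, (mG v).IsCanonical (fun x => IsRegularElt (x.val : GL (Fin 3) (UnitaryGroup.LocalRing L v))) (ν v))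
    (mGi : OrbitalMeasureFamily (UnitaryGroup.arch (↥(maximalRealSubfield L)) L (IsCMField.complexConj L) 3 H'))
    (hadmA : mGi.IsAdmissibleOn fun a => IsRegularElt (a.val : GL (Fin 3) (mixedEmbedding.mixedSpace L)))
    (T : UnitaryGroup.PureTensor L 3 H') (hT : T.IsTest)
    (νH : ∀ v : HeightOneSpectrum (𝓞 ↥(maximalRealSubfield L)), Measure (pairLocal L (Matrix.of fun i j : Fin 2 => if i.val + j.val + 1 = 2 then (1 : L) else 0) (Matrix.of fun i j : Fin 1 => if i.val + j.val + 1 = 1 then (1 : L) else 0) v))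
    [∀ v, (νH v).IsHaarMeasure] [∀ v, (νH v).IsMulRightInvariant]
    (hνH : ∀ v, νH v ((UnitaryGroup.cmLocalIntegralLevel L 2 (Matrix.of fun i j : Fin 2 => if i.val + j.val + 1 = 2 then (1 : L) else 0) v : Set ((UnitaryGroup.cmDatum L 2 (Matrix.of fun i j : Fin 2 => if i.val + j.val + 1 = 2 then (1 : L) else 0)).Local v)) ×ˢ
      (UnitaryGroup.cmLocalIntegralLevel L 1 (Matrix.of fun i j : Fin 1 => if i.val + j.val + 1 = 1 then (1 : L) else 0) v : Set ((UnitaryGroup.cmDatum L 1 (Matrix.of fun i j : Fin 1 => if i.val + j.val + 1 = 1 then (1 : L) else 0)).Local v))) = 1)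
    (mH : ∀ v : HeightOneSpectrum (𝓞 ↥(maximalRealSubfield L)), OrbitalMeasureFamily (pairLocal L (Matrix.of fun i j : Fin 2 => if i.val + j.val + 1 = 2 then (1 : L) else 0) (Matrix.of fun i j : Fin 1 => if i.val + j.val + 1 = 1 then (1 : L) else 0) v))
    (mHi : OrbitalMeasureFamily (pairArch L (Matrix.of fun i j : Fin 2 => if i.val + j.val + 1 = 2 then (1 : L) else 0) (Matrix.of fun i j : Fin 1 => if i.val + j.val + 1 = 1 then (1 : L) else 0)))
    (hadmH : ∀ v, (mH v).IsAdmissibleOn (IsLocalGRegular L v)) (hcanH : ∀ v, (mH v).IsCanonical (IsLocalGRegular L v) (νH v))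
    (hadmAH : mHi.IsAdmissibleOn (IsArchGRegular L))
    (TH : PureTensor₂ L (Matrix.of fun i j : Fin 2 => if i.val + j.val + 1 = 2 then (1 : L) else 0) (Matrix.of fun i j : Fin 1 => if i.val + j.val + 1 = 1 then (1 : L) else 0)) (hTH : TH.IsUnramified₂) (hTc : ∀ v ∈ TH.S, HasCompactSupport (TH.loc v)) (hTa : HasCompactSupport TH.arch)
    (hTc' : ∀ v ∈ TH.S, Continuous (TH.loc v)) (hTa' : Continuous TH.arch)
    (hloc : ∀ v, IsLocalDeltaTransfer L H' v (Δ v) (mH v) (mG v) (TH.loc v) (T.loc v))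
    (harch : IsArchDeltaTransfer L H' Tinf mHi mGi TH.arch T.arch) :
    ∑ i, adelicKappaOrbitalSum (MatchingAdeleG₂.classes L H' H' γ₀) (W i) (UnitaryGroup.OrbitalMeasureFamily.ofLocalAdelic L 3 H' mG mGi) T.eval =
      ∑ᶠ i : {𝒪H : StableClassH (cmConjRingHom L) (Matrix.of fun i j : Fin 2 => if i.val + j.val + 1 = 2 then (1 : L) else 0)
          (Matrix.of fun i j : Fin 1 => if i.val + j.val + 1 = 1 then (1 : L) else 0) //
            𝒪H.TransfersTo H' endoForm_antidiagOne (stableClassOf (cmConjRingHom L) H' γ₀)},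
        adelicStableOrbitalIntegralH L (Quotient.out i.1) (OrbitalMeasureFamily.ofLocalAdelicPair L (Matrix.of fun i j : Fin 2 => if i.val + j.val + 1 = 2 then (1 : L) else 0) (Matrix.of fun i j : Fin 1 => if i.val + j.val + 1 = 1 then (1 : L) else 0) mH mHi) TH.eval := by
  rw [← finsum_eq_sum_of_fintype]
  exact finsum_congr fun i =>
    MatchingAdeleG₂.adelicKappaOrbitalSum_classes_eq_adelicStableOrbitalIntegralH_of_globalKappaFormula hH' hdet hreg Δ hΔ Tinf 𝓡 obs e hκ W hW ν hν mG hcan mGi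
      hadmA T hT νH hνH mH mHi hadmH hcanH hadmAH TH hTH hTc hTa hTc' hTa' hloc harch i (StableClassH.stableClassHOf_out i.1)

/-! ## §3 The engine line: `Φ^st_{μA}(𝒪_st(γ₀), f′) = r · (#I + 1)⁻¹ · (Φ^{st,𝐀}_{G′}(γ₀, f′) + Σᶠ_{𝒪H ↦ 𝒪} Φ^{st,𝐀}_H(𝒪H.out, f′^H))` -/

/-- **THE REGULAR ELLIPTIC TERM OF THE INNER FORM, PRE-STABILISED AND Δ-TRANSFERRED, CLASS BY CLASS.**  `H′` ANISOTROPIC hermitian, `γ₀ ∈ U(H′)(L⁺)` regular; the kit's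
adelic family `μA` reading `μA c = ofReal r • ofLocal mG mGi c` on the rational classes of `𝒪_st(γ₀)` (`0 ≤ r`); the analytic data of ★ G2 VERBATIM (canonical `mG`, `mH`,
admissible `mGi`, `mHi`, `IsTest` pure tensor `T` on `G′(𝐀)`, its Δ-transfer `T^H` on `H(𝐀)`); and a stabilisation package for `γ₀` in ED. 4's shapes — finite `𝓡 ≤ Â`,
obstruction `obs` on the self carrier with Prop. 3.3.1 `hHasse`, the (5.4.5) bijection `e : {𝒪H ↦ 𝒪_st(γ₀)} ≃ 𝓡 ∖ {1}`, class weights `W` reading `e ∘ obs` (`hW`), and the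
κ-clause (4.3.3) `hκ` for the Langlands–Shelstad `Δ`.  THEN
`Φ^st_{μA}(𝒪_st(γ₀), T.eval) = r · (#{𝒪H ↦ 𝒪_st(γ₀)} + 1)⁻¹ · (Φ^{st,𝐀}_{G′}(γ₀; ofLocalAdelic mG mGi; T.eval) + Σᶠ_{𝒪H ↦ 𝒪_st(γ₀)} Φ^{st,𝐀}_H(𝒪H.out; ofLocalAdelicPair mH mHi; T^H.eval))`
— print's `J(𝒪_st, f′) = |𝓡|⁻¹ (Φ^{st}(γ₀, f′) + Σ_{κ ≠ 1} Δ(γ_H, γ₀) Φ^{st}(γ_H, f′^H))` for the inner form at a regular class, `|𝓡(G_γ₀∕F)| = 1 + #{𝒪H ↦ 𝒪}` read off `e`,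
`k(γ₀) = 1` and every finiteness DISCHARGED (★ spine).  Left to the engine's pins: the `κ = 1` inner transfer of the first term (★ G1) and the constants.
[cite: Rogawski1990, §5.4 (5.4.1)–(5.4.5) pp. 72–74; §4.3 (4.3.3) p. 44; §14.5 Thm. 14.5.1 (a) p. 238] [cite: Kottwitz1986, Prop. 7.1, §9] [cite: LanglandsShelstad1987, Thm. 6.4.B] -/
theorem adelicStableOrbitalIntegral_stableClassOf_eq_mul_inv_natCard_add_one_mul_of_globalKappaFormula
    (hanis : ∀ x : Fin 3 → L, Literature.AlgebraicGeometry.ShimuraVarieties.hermForm (cmConjRingHom L) H' x x = 0 → x = 0) (hH' : (H'.map (cmConjRingHom L))ᵀ = H')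
    (hreg : IsRegularElt (γ₀.val : GL (Fin 3) L))
    (Δ : ∀ v : HeightOneSpectrum (𝓞 ↥(maximalRealSubfield L)), LocalTransferFactor L H' v) (hΔ : IsAlmostEverywhereTrivial L H' Δ)
    (Tinf : ArchTransferFactor L H')
    {A : Type} [AddCommGroup A] (𝓡 : Subgroup (AddChar A ℂ)) [Fintype 𝓡] (obs : MatchingAdeleG₂ L H' H' γ₀ → A)
    (e : {𝒪H : StableClassH (cmConjRingHom L) (Matrix.of fun i j : Fin 2 => if i.val + j.val + 1 = 2 then (1 : L) else 0)
        (Matrix.of fun i j : Fin 1 => if i.val + j.val + 1 = 1 then (1 : L) else 0) //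
          𝒪H.TransfersTo H' endoForm_antidiagOne (stableClassOf (cmConjRingHom L) H' γ₀)} ≃ {χ : 𝓡 // χ ≠ 1})
    (hHasse : ∀ p : MatchingAdeleG₂ L H' H' γ₀, (∀ κ ∈ 𝓡, κ (obs p) = 1) ↔ ∃ γ, p.IsRationalOver γ)
    (hκ : ∀ (γH : (UnitaryGroup.cmDatum L 2 (Matrix.of fun i j : Fin 2 => if i.val + j.val + 1 = 2 then (1 : L) else 0)).Rational ×
        (UnitaryGroup.cmDatum L 1 (Matrix.of fun i j : Fin 1 => if i.val + j.val + 1 = 1 then (1 : L) else 0)).Rational) (hγ : IsNormPair L H' γH γ₀),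
      GlobalKappaFormula L H' Δ Tinf.Δ (fun p : MatchingAdele L H' γH => obs (MatchingAdele.toSelf hγ p))
        ((e ⟨stableClassHOf (cmConjRingHom L) _ _ γH, hγ⟩).1 : AddChar A ℂ))
    (W : {𝒪H : StableClassH (cmConjRingHom L) (Matrix.of fun i j : Fin 2 => if i.val + j.val + 1 = 2 then (1 : L) else 0)
        (Matrix.of fun i j : Fin 1 => if i.val + j.val + 1 = 1 then (1 : L) else 0) //
          𝒪H.TransfersTo H' endoForm_antidiagOne (stableClassOf (cmConjRingHom L) H' γ₀)} → ConjClasses (UnitaryGroup.cmDatum L 3 H').Adelic → ℂ)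
    (hW : ∀ i (q : MatchingAdeleG₂ L H' H' γ₀), W i (ConjClasses.mk q.adele) = (((e i : {χ : 𝓡 // χ ≠ 1}) : 𝓡) : AddChar A ℂ) (obs q))
    (ν : ∀ v : HeightOneSpectrum (𝓞 ↥(maximalRealSubfield L)), Measure ((UnitaryGroup.cmDatum L 3 H').Local v))
    [∀ v, (ν v).IsHaarMeasure] [∀ v, (ν v).IsMulRightInvariant]
    (hν : ∀ v, ν v (UnitaryGroup.cmLocalIntegralLevel L 3 H' v) = 1)
    (mG : ∀ v : HeightOneSpectrum (𝓞 ↥(maximalRealSubfield L)), OrbitalMeasureFamily ((UnitaryGroup.cmDatum L 3 H').Local v))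
    (hcan : ∀ v, (mG v).IsCanonical (fun x => IsRegularElt (x.val : GL (Fin 3) (UnitaryGroup.LocalRing L v))) (ν v))
    (mGi : OrbitalMeasureFamily (UnitaryGroup.arch (↥(maximalRealSubfield L)) L (IsCMField.complexConj L) 3 H'))
    (hadmA : mGi.IsAdmissibleOn fun a => IsRegularElt (a.val : GL (Fin 3) (mixedEmbedding.mixedSpace L)))
    (μA : UnitaryGroup.AdelicOrbitalMeasureFamily L 3 H') {r : ℝ} (hr : 0 ≤ r)
    (hμA : ∀ c ∈ conjClassesIn (cmConjRingHom L) H' γ₀, μA c = ENNReal.ofReal r • UnitaryGroup.AdelicOrbitalMeasureFamily.ofLocal L 3 H' mG mGi c)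
    (T : UnitaryGroup.PureTensor L 3 H') (hT : T.IsTest)
    (νH : ∀ v : HeightOneSpectrum (𝓞 ↥(maximalRealSubfield L)), Measure (pairLocal L (Matrix.of fun i j : Fin 2 => if i.val + j.val + 1 = 2 then (1 : L) else 0) (Matrix.of fun i j : Fin 1 => if i.val + j.val + 1 = 1 then (1 : L) else 0) v))
    [∀ v, (νH v).IsHaarMeasure] [∀ v, (νH v).IsMulRightInvariant]
    (hνH : ∀ v, νH v ((UnitaryGroup.cmLocalIntegralLevel L 2 (Matrix.of fun i j : Fin 2 => if i.val + j.val + 1 = 2 then (1 : L) else 0) v : Set ((UnitaryGroup.cmDatum L 2 (Matrix.of fun i j : Fin 2 => if i.val + j.val + 1 = 2 then (1 : L) else 0)).Local v)) ×ˢ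
      (UnitaryGroup.cmLocalIntegralLevel L 1 (Matrix.of fun i j : Fin 1 => if i.val + j.val + 1 = 1 then (1 : L) else 0) v : Set ((UnitaryGroup.cmDatum L 1 (Matrix.of fun i j : Fin 1 => if i.val + j.val + 1 = 1 then (1 : L) else 0)).Local v))) = 1)
    (mH : ∀ v : HeightOneSpectrum (𝓞 ↥(maximalRealSubfield L)), OrbitalMeasureFamily (pairLocal L (Matrix.of fun i j : Fin 2 => if i.val + j.val + 1 = 2 then (1 : L) else 0) (Matrix.of fun i j : Fin 1 => if i.val + j.val + 1 = 1 then (1 : L) else 0) v))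
    (mHi : OrbitalMeasureFamily (pairArch L (Matrix.of fun i j : Fin 2 => if i.val + j.val + 1 = 2 then (1 : L) else 0) (Matrix.of fun i j : Fin 1 => if i.val + j.val + 1 = 1 then (1 : L) else 0)))
    (hadmH : ∀ v, (mH v).IsAdmissibleOn (IsLocalGRegular L v)) (hcanH : ∀ v, (mH v).IsCanonical (IsLocalGRegular L v) (νH v))
    (hadmAH : mHi.IsAdmissibleOn (IsArchGRegular L))
    (TH : PureTensor₂ L (Matrix.of fun i j : Fin 2 => if i.val + j.val + 1 = 2 then (1 : L) else 0) (Matrix.of fun i j : Fin 1 => if i.val + j.val + 1 = 1 then (1 : L) else 0)) (hTH : TH.IsUnramified₂) (hTc : ∀ v ∈ TH.S, HasCompactSupport (TH.loc v)) (hTa : HasCompactSupport TH.arch)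
    (hTc' : ∀ v ∈ TH.S, Continuous (TH.loc v)) (hTa' : Continuous TH.arch)
    (hloc : ∀ v, IsLocalDeltaTransfer L H' v (Δ v) (mH v) (mG v) (TH.loc v) (T.loc v))
    (harch : IsArchDeltaTransfer L H' Tinf mHi mGi TH.arch T.arch) :
    UnitaryGroup.adelicStableOrbitalIntegral L 3 H' μA T.eval (stableClassOf (cmConjRingHom L) H' γ₀) =
      (r : ℂ) * (((Nat.card {𝒪H : StableClassH (cmConjRingHom L) (Matrix.of fun i j : Fin 2 => if i.val + j.val + 1 = 2 then (1 : L) else 0)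
          (Matrix.of fun i j : Fin 1 => if i.val + j.val + 1 = 1 then (1 : L) else 0) //
            𝒪H.TransfersTo H' endoForm_antidiagOne (stableClassOf (cmConjRingHom L) H' γ₀)} + 1 : ℕ) : ℂ)⁻¹ *
        (adelicStableOrbitalSum (MatchingAdeleG₂.classes L H' H' γ₀) (UnitaryGroup.OrbitalMeasureFamily.ofLocalAdelic L 3 H' mG mGi) T.eval +
          ∑ᶠ i : {𝒪H : StableClassH (cmConjRingHom L) (Matrix.of fun i j : Fin 2 => if i.val + j.val + 1 = 2 then (1 : L) else 0)
              (Matrix.of fun i j : Fin 1 => if i.val + j.val + 1 = 1 then (1 : L) else 0) //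
                𝒪H.TransfersTo H' endoForm_antidiagOne (stableClassOf (cmConjRingHom L) H' γ₀)},
            adelicStableOrbitalIntegralH L (Quotient.out i.1) (OrbitalMeasureFamily.ofLocalAdelicPair L (Matrix.of fun i j : Fin 2 => if i.val + j.val + 1 = 2 then (1 : L) else 0) (Matrix.of fun i j : Fin 1 => if i.val + j.val + 1 = 1 then (1 : L) else 0) mH mHi) TH.eval)) := by
  classical
  haveI := StableClassH.finite_subtype_transfersTo_antidiagOne L H' (stableClassOf (cmConjRingHom L) H' γ₀)
  haveI : Fintype {𝒪H : StableClassH (cmConjRingHom L) (Matrix.of fun i j : Fin 2 => if i.val + j.val + 1 = 2 then (1 : L) else 0)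
      (Matrix.of fun i j : Fin 1 => if i.val + j.val + 1 = 1 then (1 : L) else 0) //
        𝒪H.TransfersTo H' endoForm_antidiagOne (stableClassOf (cmConjRingHom L) H' γ₀)} := Fintype.ofFinite _
  have hdet : H'.det ≠ 0 := Godement.det_ne_zero_of_anisotropic L H' hanis
  obtain ⟨hmain, hcard⟩ := adelicStableOrbitalIntegral_stableClassOf_eq_mul_inv_card_mul_of_equiv hanis hH' ν hν mG hcan mGi hadmA hreg μA hr hμA T hT 𝓡 obs e
    hHasse W hW
  rw [hmain, hcard, Nat.card_eq_fintype_card,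
    MatchingAdeleG₂.sum_adelicKappaOrbitalSum_classes_eq_finsum_adelicStableOrbitalIntegralH_out_of_globalKappaFormula hH' hdet hreg Δ hΔ Tinf 𝓡 obs e hκ W hW ν hν
      mG hcan mGi hadmA T hT νH hνH mH mHi hadmH hcanH hadmAH TH hTH hTc hTa hTc' hTa' hloc harch]

end PerClass

end Literature.NumberTheory.Rogawski1990

end
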